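import Summits.QuantumFields.BalabanUV.T4Continuum.Spine.NE3.PairLandauB8Avg
import Literature.MathematicalPhysics.QuantumFieldTheory.Balaban1983to89.B8Eq115GaugeFixing
import HarnessLib

/-!
# T⁴ programme, node NE3 — census R49: THE (1.37) CLAUSE OF `PairLandauGaugeB8Avg` AT THE PAIR IS A FRAME CONDITION ON THE GAUGE —
# `dbar ↔ (u_k⁻¹·v_k) ∈ Stab(V)`, from [Balaban1985Averaging] (92)∕(159) and (11) alone (`PairFrameCondition`)

Cell `pub-balaban-gaps` (track G2, seat ne3, generation 11), row NE3 of `BALABAN-GAPS.md`; census `HOME/ne/NE3.md` §4 R49, §17.  Context: after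
generation 10 the local half of NE3 over Bałaban's small-field class is EXACTLY the TYPE `PairLandauB8Avg.PairLandauGaugeB8Avg` ([Balaban1985RegularSpaces]
(«B8») Thm 2 + (1.37) ∘ [Balaban1985Variational] Thm 1, read at the minimiser pair) plus the leaf (H3ˢᵘᵖ) (`PairLandauB8EndSfClassHP.ne3EnergyRateWCov_sfClass_small_lineFree`,
p396369).  The row-NE3 OWNER lineage (b2b-balaban-t4-ne3-p1, gen 27) is landing [B8] Sect. E Prop. 5's GAUGE EXISTENCE relative to a curved background
(`Spine/NE3/CurvedLandauRep.exists_landauRep_W`: the members `rep ∕ landau ∕ sup` of `LandauRepB8` from (−1)∕(−2)-size relative data, by a Newton scheme on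
`N(Q′(W))`), which by its own docstring does NOT deliver the (1.37) average condition `LandauRepB8Avg.dbar`.  THIS FILE LOCATES, IN KERNEL, WHAT (1.37) ASKS OF
THE GAUGE AT THE PAIR — nothing analytic, pure group algebra over the b07 lineage's identities:

* §1 `avgIter_eq_of_rep` — if `U_A^{u} = W·e^{Z}` (`LandauRepB8.rep`, i.e. `U_A = (U′·W)^{u⁻¹}` with B8's perturbation `U′ = relPert W Z`), then by the
  FUNDAMENTAL EQUALITY [Balaban1985Averaging] (92)∕(159) (`B7Eq92Concrete.avgIter_mul_eq_gaugeAct`: `(U′W)‾ᵏ = (U̿′ᵏ·W̄ᵏ)^{v_k}`, `v_k = vcov` the accumulated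
  frame (97)) and the gauge covariance (11) of the `k`-fold average (`B7Prop6Flat.avgIter_gaugeAct_units`, `u_k = uLev L u k = u ∘ (L^k•)`):
  `Ū_Aᵏ = (U̿′ᵏ · W̄ᵏ)^{g}` with the COARSE FRAME GAUGE `g := u_k⁻¹ · v_k(U′)`.
* §1 `dbar_iff_avgIter` — hence (1.37) with `B = 0`, `U̿′ᵏ = 1` (`dbavgCovIter L W (relPert W Z) k = 1`), holds IFF `Ū_Aᵏ = (W̄ᵏ)^{g}`.
* §2 AT THE PAIR (`Ū_Aᵏ = V = W̄ᵏ`: both minimisers carry the datum `V`, `MinimalActionSandwich.admissible` + `MinimalActionLevels.avgIter_rescale_bavg`):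
  **`dbar ↔ V^{g} = V`** (`dbar_iff_stab`, `dbar_iff_stab_pair`) — (1.37) is the statement that the coarse frame gauge `u_k⁻¹·v_k(U′)` STABILISES THE DATUM;
  in particular it HOLDS when the accumulated frame of the perturbation equals the corner values of the gauge, `v_k(U′) = u_k` (`dbar_of_frame_eq`) — the
  tree's reading of B8's restriction (1.29) «(R₀ū)ʲ = 1» together with [Balaban1985Averaging] (99) «\overline{R_{0,x}U₁^{(j)}} = v_j(x)».
* §3 `landauRepB8Avg_of_stab`, **`pairLandauGaugeB8Avg_iff_frame`** — `PairLandauGaugeB8Avg d 𝒞 L N b g s₁ s₂ β dom` is EQUIVALENT to «`PairLandauGaugeB8`'s body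
  `LandauRepB8` at every pair TOGETHER WITH the stabiliser condition `V^{u_k⁻¹·v_k} = V` for the same `(u, Z)`»: the exact converse of `PairLandauGaugeB8Avg.toPair`.
  Consequence for census R4 (recorded, not proved here): a Landau step whose gauge is a product of `e^{λ}`, `λ ∈ N(Q′(W))` (the owner's brick E′) must be
  COMPOSED with a coarse normalisation solving `V^{u_k⁻¹ v_k(U′)} = V` before THE END can consume it — [B8] Prop. 5's `B`-component ∕ (1.29), a separate item.
* §4 `stab_of_flat_pair` — non-vacuity: at `Z = 0`, `u = 1` the condition holds (`dbavgCovIter_one_right`).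

HONEST FRAMING (page 1).  Group algebra about OUR typed objects (`relPert`, `dbavgCovIter`, `vcov`, `uLev`, `avgIter`, `gaugeAct`); 0 def, 0 sorry; every
identity used is a LANDED tree theorem of the b07 lineage, cited by name.  Nothing of Bałaban's is asserted or discharged: [B8] Thm 2 ∕ Prop. 5, [B11] Thm 1
remain TYPES; `PairLandauGaugeB8Avg`, the covariant root and **NE3 are NOT proved**; spine PROVED 0∕9; finite T⁴ rung (B)+1 — NOT continuum YM on ℝ⁴, NOT
infinite volume, NOT mass gap, NOT `BetaPertH`, NOT Clay.  HONEST DEPENDENCY: continuum YM on T⁴ ⇐ BetaPertH ∧ nine spine estimates (0/9 proved); BetaPertH ⇐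
(D1) ∧ (D4) ∧ CAP+tail; G-an2-4 gates asym, D1 and NE2/3/4.  PLACEMENT: `Summits/QuantumFields/BalabanUV/T4Continuum/Spine/NE3/`; imports the accepted
`Spine/NE3/PairLandauB8Avg` and the Literature module `B8Eq115GaugeFixing` (`gaugeAct_mul`) only.

References: [Balaban1985Averaging] T. Bałaban, *Averaging operations for lattice gauge theories*, CMP 98 (1985) 17–51, (11) p. 19, (92) p. 31, (97)∕(99)
p. 32, (159) p. 42; [Balaban1985RegularSpaces] T. Bałaban, *Spaces of regular gauge field configurations on a lattice and gauge fixing conditions*, CMP 99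
(1985) 75–102, (1.29) p. 80, (1.31) p. 82, (1.37) p. 82.
-/

set_option autoImplicit false

open scoped BigOperators Matrix Matrix.Norms.L2Operator
open NormedSpace

namespace Summit.QuantumFields.BalabanUV.T4Continuum.NE3.PairFrameCondition

open Literature.MathematicalPhysics.QuantumFieldTheory.Balaban1983to89
open B7Prop1Explicit B7Prop2Explicit
open B7AvgGaugeCovariance (uLev)
open B7Prop6Flat (avgIter_gaugeAct_units)
open B7Eq92Concrete (vcov dbavgCovIter avgIter_mul_eq_gaugeAct)
open B8Eq115GaugeFixing (gaugeAct_mul)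
open B8Ineq130 (gaugeAct_one)
open T4AveragingDeficitWall (vary)
open MinimalActionSandwich (IsMinimiser)
open MinimalActionRate (Regular)
open MinimalActionLevels (avgIter_rescale_bavg)
open NE3.PairLandauB8 (LandauRepB8 PairLandauGaugeB8)
open NE3.PairLandauB8Avg (relPert relPert_mul_eq_vary relPert_zero dbavgCovIter_one_right LandauRepB8Avg PairLandauGaugeB8Avg)

noncomputable section

variable {d : ℕ} {n : Type*} [Fintype n] [DecidableEq n]

/-! ## §1 The average of the represented configuration: (92)∕(159) composed with (11) -/

/-- `V^{u⁻¹ u} = V`: undoing a gauge transformation ([Balaban1985Averaging] (8); `gaugeAct_mul`, `gaugeAct_one`). [folklore] -/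
theorem gaugeAct_inv_gaugeAct (u : Site d → (Matrix n n ℂ)ˣ) (V : Site d → Fin d → (Matrix n n ℂ)ˣ) :
    gaugeAct u⁻¹ (gaugeAct u V) = V := by
  rw [← gaugeAct_mul, inv_mul_cancel, gaugeAct_one]

/-- A gauge transformation is injective on configurations. [folklore] -/
theorem gaugeAct_injective (u : Site d → (Matrix n n ℂ)ˣ) :
    Function.Injective (gaugeAct u : (Site d → Fin d → (Matrix n n ℂ)ˣ) → (Site d → Fin d → (Matrix n n ℂ)ˣ)) := by
  intro V V' h
  have := congrArg (gaugeAct u⁻¹) h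
  rwa [gaugeAct_inv_gaugeAct, gaugeAct_inv_gaugeAct] at this

/-- The dictionary (R-c) as a product of configurations: `relPert W Z · W = vary W Z 1` (`PairLandauB8Avg.relPert_mul_eq_vary`). [folklore] -/
theorem relPert_mul_eq_vary' (W : Site d → Fin d → (Matrix n n ℂ)ˣ) (Z : Site d → Fin d → Matrix n n ℂ) :
    relPert W Z * W = vary W Z 1 :=
  relPert_mul_eq_vary W Z

/-- **`rep` SOLVED FOR `U_A`**: `U_A^{u} = W·e^{Z}` gives `U_A = (U′·W)^{u⁻¹}` with B8's perturbation `U′ = relPert W Z` ([Balaban1985RegularSpaces] (1.16) «U = U′U₀»,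
reading (R-c)). [folklore] -/
theorem eq_gaugeAct_inv_of_rep {u : Site d → (Matrix n n ℂ)ˣ} {UA W : Site d → Fin d → (Matrix n n ℂ)ˣ} {Z : Site d → Fin d → Matrix n n ℂ}
    (hrep : gaugeAct u UA = vary W Z 1) : UA = gaugeAct u⁻¹ (relPert W Z * W) := by
  rw [relPert_mul_eq_vary', ← hrep, gaugeAct_inv_gaugeAct]

/-- **THE `k`-FOLD AVERAGE OF THE REPRESENTED CONFIGURATION** ([Balaban1985Averaging] (159) ∘ (11)): if `U_A^{u} = W·e^{Z}` then
`Ū_Aᵏ = (U̿′ᵏ · W̄ᵏ)^{g}` with `U′ = relPert W Z`, `U̿′ᵏ = dbavgCovIter L W U′ k` the `k`-fold double-bar average (91), and the COARSE FRAME GAUGE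
`g = u_k⁻¹ · v_k(U′)` (`u_k = uLev L u k` the corner values of `u` on `Ω^{(k)}`, `v_k = vcov L W U′ k` the accumulated frame (97)). [folklore] -/
theorem avgIter_eq_of_rep (L k : ℕ) {u : Site d → (Matrix n n ℂ)ˣ} {UA W : Site d → Fin d → (Matrix n n ℂ)ˣ}
    {Z : Site d → Fin d → Matrix n n ℂ} (hrep : gaugeAct u UA = vary W Z 1) :
    avgIter L UA k
      = gaugeAct (uLev L u⁻¹ k * vcov L W (relPert W Z) k) (dbavgCovIter L W (relPert W Z) k * avgIter L W k) := by
  rw [eq_gaugeAct_inv_of_rep hrep, avgIter_gaugeAct_units, avgIter_mul_eq_gaugeAct, ← gaugeAct_mul]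

/-- **(1.37) WITH `B = 0` AS A CONDITION ON THE AVERAGES**: under `U_A^{u} = W·e^{Z}`, `U̿′ᵏ = 1` iff `Ū_Aᵏ = (W̄ᵏ)^{g}` with the coarse frame gauge
`g = u_k⁻¹ · v_k(U′)` of `avgIter_eq_of_rep`. [folklore] -/
theorem dbar_iff_avgIter (L k : ℕ) {u : Site d → (Matrix n n ℂ)ˣ} {UA W : Site d → Fin d → (Matrix n n ℂ)ˣ}
    {Z : Site d → Fin d → Matrix n n ℂ} (hrep : gaugeAct u UA = vary W Z 1) :
    dbavgCovIter L W (relPert W Z) k = 1 ↔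
      avgIter L UA k = gaugeAct (uLev L u⁻¹ k * vcov L W (relPert W Z) k) (avgIter L W k) := by
  have h0 := avgIter_eq_of_rep L k hrep
  constructor
  · intro h
    rw [h0, h, one_mul]
  · intro h
    rw [h] at h0
    have h1 := gaugeAct_injective _ h0
    have h2 : (1 : Site d → Fin d → (Matrix n n ℂ)ˣ) * avgIter L W k = dbavgCovIter L W (relPert W Z) k * avgIter L W k := by
      rw [one_mul]; exact h1
    exact (mul_right_cancel h2).symm

/-! ## §2 At the pair: both configurations carry the datum `V`, and (1.37) becomes a stabiliser condition -/

/-- **(1.37) AT A PAIR WITH COMMON AVERAGE `V` IS THE STABILISER CONDITION `V^{g} = V`**, `g = u_k⁻¹ · v_k(U′)`. [folklore] -/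
theorem dbar_iff_stab (L k : ℕ) {u : Site d → (Matrix n n ℂ)ˣ} {UA W V : Site d → Fin d → (Matrix n n ℂ)ˣ}
    {Z : Site d → Fin d → Matrix n n ℂ} (hrep : gaugeAct u UA = vary W Z 1) (hA : avgIter L UA k = V) (hW : avgIter L W k = V) :
    dbavgCovIter L W (relPert W Z) k = 1 ↔ gaugeAct (uLev L u⁻¹ k * vcov L W (relPert W Z) k) V = V := by
  rw [dbar_iff_avgIter L k hrep, hA, hW, eq_comm]

/-- Corner values of an inverse gauge function: `(u⁻¹)_k · u_k = 1`. [folklore] -/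
theorem uLev_inv_mul (L k : ℕ) (u : Site d → (Matrix n n ℂ)ˣ) : uLev L u⁻¹ k * uLev L u k = 1 := by
  funext z
  simp [uLev, Pi.mul_apply, Pi.inv_apply]

/-- **THE FRAME CONDITION IMPLIES (1.37)**: at a pair with common average, if the accumulated frame (97) of the perturbation equals the corner values of the
gauge, `v_k(U′) = u_k` — the tree's reading of B8's restriction (1.29) «(R₀ū)ʲ = 1» with [Balaban1985Averaging] (99) «\overline{R_{0,x}U₁^{(j)}} = v_j(x)» —
then `U̿′ᵏ = 1`. [folklore] -/
theorem dbar_of_frame_eq (L k : ℕ) {u : Site d → (Matrix n n ℂ)ˣ} {UA W V : Site d → Fin d → (Matrix n n ℂ)ˣ}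
    {Z : Site d → Fin d → Matrix n n ℂ} (hrep : gaugeAct u UA = vary W Z 1) (hA : avgIter L UA k = V) (hW : avgIter L W k = V)
    (hframe : vcov L W (relPert W Z) k = uLev L u k) : dbavgCovIter L W (relPert W Z) k = 1 := by
  rw [dbar_iff_stab L k hrep hA hW, hframe, uLev_inv_mul, gaugeAct_one]

/-- A minimiser of run `k` with datum `V` has `k`-fold average `V` (`MinimalActionSandwich.admissible`). [folklore] -/
theorem avgIter_eq_of_isMinimiser {𝒞 : ℕ → Set (Site d → Fin d → (Matrix n n ℂ)ˣ)} {L N k : ℕ} {V UA : Site d → Fin d → (Matrix n n ℂ)ˣ}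
    (h : IsMinimiser d 𝒞 L N k V UA) : avgIter L UA k = V :=
  h.mem.2

/-- The background `W = rescale L (bavg L U_B)` of a run-`(k+1)` minimiser has `k`-fold average `V` (`MinimalActionLevels.avgIter_rescale_bavg`). [folklore] -/
theorem avgIter_rescale_bavg_eq_of_isMinimiser {𝒞 : ℕ → Set (Site d → Fin d → (Matrix n n ℂ)ˣ)} {L N k : ℕ}
    {V UB : Site d → Fin d → (Matrix n n ℂ)ˣ} (h : IsMinimiser d 𝒞 L N (k + 1) V UB) : avgIter L (rescale L (bavg L UB)) k = V := by
  rw [avgIter_rescale_bavg]; exact h.mem.2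

/-- **(1.37) AT THE MINIMISER PAIR** (the quantifier data of `PairLandauGaugeB8Avg`): for `U_A` a run-`k` minimiser and `U_B` a run-`(k+1)` minimiser with the
same datum `V`, `W := rescale L (bavg L U_B)`, and any `(u, Z)` with `U_A^{u} = W·e^{Z}`:  `dbar ↔ V^{u_k⁻¹ · v_k(relPert W Z)} = V`. [folklore] -/
theorem dbar_iff_stab_pair {𝒞 : ℕ → Set (Site d → Fin d → (Matrix n n ℂ)ˣ)} {L N k : ℕ} {V UA UB : Site d → Fin d → (Matrix n n ℂ)ˣ}
    (hA : IsMinimiser d 𝒞 L N k V UA) (hB : IsMinimiser d 𝒞 L N (k + 1) V UB) {u : Site d → (Matrix n n ℂ)ˣ} {Z : Site d → Fin d → Matrix n n ℂ}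
    (hrep : gaugeAct u UA = vary (rescale L (bavg L UB)) Z 1) :
    dbavgCovIter L (rescale L (bavg L UB)) (relPert (rescale L (bavg L UB)) Z) k = 1 ↔
      gaugeAct (uLev L u⁻¹ k * vcov L (rescale L (bavg L UB)) (relPert (rescale L (bavg L UB)) Z) k) V = V :=
  dbar_iff_stab L k hrep (avgIter_eq_of_isMinimiser hA) (avgIter_rescale_bavg_eq_of_isMinimiser hB)

/-! ## §3 `LandauRepB8Avg` = `LandauRepB8` + the stabiliser condition; `PairLandauGaugeB8Avg` ↔ `PairLandauGaugeB8`-bodies + frame condition -/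

/-- **B8's representative WITH (1.37) from the representative WITHOUT it plus the stabiliser condition** (common average `V`). [folklore] -/
theorem landauRepB8Avg_of_stab {L N k : ℕ} {W UA V : Site d → Fin d → (Matrix n n ℂ)ˣ} {u : Site d → (Matrix n n ℂ)ˣ}
    {Z : Site d → Fin d → Matrix n n ℂ} {s₁ s₂ β : ℝ} (h : LandauRepB8 L N k W UA u Z s₁ s₂ β) (hA : avgIter L UA k = V)
    (hW : avgIter L W k = V) (hstab : gaugeAct (uLev L u⁻¹ k * vcov L W (relPert W Z) k) V = V) :
    LandauRepB8Avg L N k W UA u Z s₁ s₂ β :=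
  { h with dbar := (dbar_iff_stab L k h.rep hA hW).2 hstab }

/-- Conversely the representative WITH (1.37) satisfies the stabiliser condition. [folklore] -/
theorem stab_of_landauRepB8Avg {L N k : ℕ} {W UA V : Site d → Fin d → (Matrix n n ℂ)ˣ} {u : Site d → (Matrix n n ℂ)ˣ}
    {Z : Site d → Fin d → Matrix n n ℂ} {s₁ s₂ β : ℝ} (h : LandauRepB8Avg L N k W UA u Z s₁ s₂ β) (hA : avgIter L UA k = V)
    (hW : avgIter L W k = V) : gaugeAct (uLev L u⁻¹ k * vcov L W (relPert W Z) k) V = V :=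
  (dbar_iff_stab L k h.rep hA hW).1 h.dbar

/-- **`PairLandauGaugeB8Avg` ↔ [B8] Thm 2's body `LandauRepB8` AT EVERY PAIR + THE FRAME CONDITION for the same `(u, Z)`** — the exact converse of
`PairLandauGaugeB8Avg.toPair`: what (1.37) adds to `PairLandauGaugeB8` at the pair is precisely that the coarse frame gauge `u_k⁻¹·v_k(U′)` stabilises the
datum `V`. [folklore] -/
theorem pairLandauGaugeB8Avg_iff_frame {𝒞 : ℕ → Set (Site d → Fin d → (Matrix n n ℂ)ˣ)} {L N : ℕ} {b g s₁ s₂ β : ℝ}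
    {dom : Set (Site d → Fin d → (Matrix n n ℂ)ˣ)} :
    PairLandauGaugeB8Avg d 𝒞 L N b g s₁ s₂ β dom ↔
      ∀ k : ℕ, 1 ≤ k → ∀ V ∈ dom, ∀ UA UB : Site d → Fin d → (Matrix n n ℂ)ˣ,
        IsMinimiser d 𝒞 L N k V UA → IsMinimiser d 𝒞 L N (k + 1) V UB → Regular d L N b g (k + 1) UB →
          ∃ (u : Site d → (Matrix n n ℂ)ˣ) (Z : Site d → Fin d → Matrix n n ℂ),
            LandauRepB8 L N k (rescale L (bavg L UB)) UA u Z s₁ s₂ β ∧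
              gaugeAct (uLev L u⁻¹ k * vcov L (rescale L (bavg L UB)) (relPert (rescale L (bavg L UB)) Z) k) V = V := by
  constructor
  · intro h k hk V hV UA UB hA hB hreg
    obtain ⟨u, Z, hZ⟩ := h k hk V hV UA UB hA hB hreg
    exact ⟨u, Z, hZ.toLandauRepB8,
      stab_of_landauRepB8Avg hZ (avgIter_eq_of_isMinimiser hA) (avgIter_rescale_bavg_eq_of_isMinimiser hB)⟩
  · intro h k hk V hV UA UB hA hB hreg
    obtain ⟨u, Z, hZ, hstab⟩ := h k hk V hV UA UB hA hB hreg
    exact ⟨u, Z, landauRepB8Avg_of_stab hZ (avgIter_eq_of_isMinimiser hA) (avgIter_rescale_bavg_eq_of_isMinimiser hB) hstab⟩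

/-- **`PairLandauGaugeB8` + THE FRAME CONDITION `v_k(U′) = u_k` AT EVERY PAIR ⟹ `PairLandauGaugeB8Avg`** (the sufficient, (1.29)-type form). [folklore] -/
theorem pairLandauGaugeB8Avg_of_frame_eq {𝒞 : ℕ → Set (Site d → Fin d → (Matrix n n ℂ)ˣ)} {L N : ℕ} {b g s₁ s₂ β : ℝ}
    {dom : Set (Site d → Fin d → (Matrix n n ℂ)ˣ)}
    (h : ∀ k : ℕ, 1 ≤ k → ∀ V ∈ dom, ∀ UA UB : Site d → Fin d → (Matrix n n ℂ)ˣ,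
      IsMinimiser d 𝒞 L N k V UA → IsMinimiser d 𝒞 L N (k + 1) V UB → Regular d L N b g (k + 1) UB →
        ∃ (u : Site d → (Matrix n n ℂ)ˣ) (Z : Site d → Fin d → Matrix n n ℂ),
          LandauRepB8 L N k (rescale L (bavg L UB)) UA u Z s₁ s₂ β ∧
            vcov L (rescale L (bavg L UB)) (relPert (rescale L (bavg L UB)) Z) k = uLev L u k) :
    PairLandauGaugeB8Avg d 𝒞 L N b g s₁ s₂ β dom := by
  intro k hk V hV UA UB hA hB hreg
  obtain ⟨u, Z, hZ, hframe⟩ := h k hk V hV UA UB hA hB hreg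
  refine ⟨u, Z, { hZ with dbar := ?_ }⟩
  exact dbar_of_frame_eq L k hZ.rep (avgIter_eq_of_isMinimiser hA) (avgIter_rescale_bavg_eq_of_isMinimiser hB) hframe

/-! ## §4 Non-vacuity: the trivial representative of `W` relative to itself -/

/-- At `Z = 0`, `u = 1` (so `U_A = W`) the stabiliser condition holds: `g = v_k(1) = 1`-action on `V` is trivial — read off (1.37) for the trivial
perturbation (`dbavgCovIter_one_right`) through `dbar_iff_stab`. [folklore] -/
theorem stab_of_flat_pair (L k : ℕ) {W V : Site d → Fin d → (Matrix n n ℂ)ˣ} (hW : avgIter L W k = V) :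
    gaugeAct (uLev L (1 : Site d → (Matrix n n ℂ)ˣ)⁻¹ k
        * vcov L W (relPert W (fun (_ : Site d) (_ : Fin d) => (0 : Matrix n n ℂ))) k) V = V := by
  have hrep : gaugeAct (1 : Site d → (Matrix n n ℂ)ˣ) W = vary W (fun (_ : Site d) (_ : Fin d) => (0 : Matrix n n ℂ)) 1 := by
    rw [gaugeAct_one, ← relPert_mul_eq_vary', relPert_zero, one_mul]
  exact (dbar_iff_stab L k hrep hW hW).1 (by rw [relPert_zero, dbavgCovIter_one_right])

end

end Summit.QuantumFields.BalabanUV.T4Continuum.NE3.PairFrameCondition
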